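import Mathlib
import Literature.Computability.AlgebraicComplexity.RazElusiveGeneralDefinable

/-!
# `RazTransfer` (stmt-ValiantsHypothesis-8497), part 2 — Valiant's criterion for polynomial
MAPPINGS: poly(`n`)-definability from exponent-bit circuits

Raz (2010), remark after Def. 1.3 (p. 142): "if `f` is multilinear with all coefficients in
`{0,1}` and there is a polynomial-time machine that on inputs `i` and a monomial outputs its
coefficient in `f_i`, then `f` is poly(`n`)-definable" (Valiant's criterion, Bürgisser 2000,
Prop. 2.20, for mappings). We prove the circuit form needed by the route: if the coordinates are
sums of `2^t` multilinear monomials whose exponent BIT-VECTORS are computed, from the bits of the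
index `i` and `t` selector bits, by `B₂`-circuits of size `s(n)` with `s, t` p-bounded, then the
family is `IsPolyDefinableMap` (Def. 1.3). The witness at one index is
`G = VALID(C)(w, c, u) · ∏_{j<n} (1 + u_{out j} · (x_j − 1))` — the Cook–Levin/Valiant transcript
polynomial of the circuit (`CircuitArith.validPoly`) times the monomial selector — whose Boolean
sum over `(c, u)` with `w := bits(i)` is `f_i` (`WDatum.boolSum_G`), of size `≤ 60 s + 4 n + 1`
and degree `≤ 3 s + 2 n`; the pattern is that of `RazDefinable.Datum`
(`RazElusiveGeneralDefinable.lean`, Raz's Prop. 5.5) with the index bits substituted rather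
than summed.

References: R. Raz, *Elusive functions and lower bounds for arithmetic circuits*, Theory of
Computing 6 (2010), Def. 1.3 and the remark after it; P. Bürgisser, *Completeness and Reduction
in Algebraic Complexity Theory* (2000), Prop. 2.20; L. G. Valiant, *Completeness classes in
algebra*, STOC 1979.
-/

set_option linter.dupNamespace false

noncomputable section

namespace Summit.ValiantsHypothesis.ValiantsHypothesis.Theorems.BinomialElusiveRazTransfer

open MvPolynomial Literature.Computability.AlgebraicComplexity Literature.Computability.Complexity
  CircuitArith

universe u

variable {k : Type u} [CommRing k]

/-- The multilinear monomial selected by a bit vector: `∏_{j<n} (x_j if b_j else 1)`. -/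
def selMonomial (n : ℕ) (b : Fin n → Bool) : MvPolynomial (Fin n) k :=
  ∏ j : Fin n, if b j then X j else 1

/-- The selector factor at a Boolean point: `1 + [b] (P - 1)` is `P` or `1`. -/
theorem one_add_C_toK_mul {σ : Type*} (b : Bool) (P : MvPolynomial σ k) :
    1 + C (toK k b) * (P + C (-1)) = if b then P else 1 := by
  cases b
  · simp
  · rw [toK_true, C_1, one_mul, if_pos rfl, C_neg, C_1]; ring

/-- `if b then 1 else 0 = C [b]`. -/
theorem ite_eq_C_toK {σ : Type*} (b : Bool) :
    (if b then (1 : MvPolynomial σ k) else 0) = C (toK k b) := by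
  cases b <;> simp [toK]

/-- Splitting a sum over bit vectors of length `t + L` into the two blocks. -/
theorem sum_boolVec_add {A : Type*} [AddCommMonoid A] (t L : ℕ)
    (H : (Fin t → Bool) → (Fin L → Bool) → A) :
    ∑ e : Fin (t + L) → Bool, H (fun c => e (Fin.castAdd L c)) (fun u => e (Fin.natAdd t u)) =
      ∑ c : Fin t → Bool, ∑ u : Fin L → Bool, H c u := by
  let ε : (Fin (t + L) → Bool) ≃ (Fin t → Bool) × (Fin L → Bool) :=
    (Equiv.arrowCongr finSumFinEquiv.symm (Equiv.refl Bool)).trans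
      (Equiv.sumArrowEquivProdArrow (Fin t) (Fin L) Bool)
  rw [← Fintype.sum_prod_type' H]
  exact Fintype.sum_equiv ε _ (fun p => H p.1 p.2) fun e => rfl

/-! ### The witness at one index -/

/-- The data at one index: `n` variables, `K` index bits, `t ≥ 1` selector bits, and a realized
`B₂` gate list computing the exponent bit-vectors `D`. -/
structure WDatum where
  /-- number of `x`-variables -/
  n : ℕ
  /-- number of index bits `w` -/
  K : ℕ
  /-- number of selector bits `c` -/
  t : ℕ
  /-- there is at least one selector bit (its input wire serves as the circuit's nominal output) -/
  ht : 0 < t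
  /-- the gates of the exponent-bit circuit -/
  gs : List (Gate (Fin K ⊕ Fin t))
  /-- its `n` output wires -/
  out : Fin n → (Fin K ⊕ Fin t) ⊕ ℕ
  /-- the bit-vector map it computes -/
  D : (Fin K ⊕ Fin t → Bool) → Fin n → Bool
  /-- the gate list realizes `D` over `B₂` -/
  real : GateList.Realizes B2 gs out D

namespace WDatum

variable (Λ : WDatum)

/-- The exponent-bit circuit as a `Circuit` (designated output: the input wire of the first
selector bit; it plays no role). -/
def Q : Circuit (Fin Λ.K ⊕ Fin Λ.t) where
  gates := Λ.gs
  output := Sum.inl (Sum.inr ⟨0, Λ.ht⟩)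
  wf j hj a m ha := Λ.real.wf j _ (List.getElem?_eq_getElem hj) a m ha
  wf_output m hm := by cases hm

/-- It is a `B₂`-circuit. -/
theorem Q_isOver : Λ.Q.IsOver B2 := fun g hg => Λ.real.isOver g hg

/-- Number of gates (transcript variables `u`). -/
abbrev L : ℕ := Λ.Q.size

/-- Number of Boolean (`e`-) variables of the witness: `t` selector bits and `L` transcript bits. -/
abbrev ℓ : ℕ := Λ.t + Λ.L

/-- The variables `(x, e, w)` of the witness, in the format of `IsPolyDefinableMap`. -/
abbrev V : Type := (Fin Λ.n ⊕ Fin Λ.ℓ) ⊕ Fin Λ.K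

/-- Placing the variables `((w, c), u)` of the transcript polynomial. -/
def ρ : (Fin Λ.K ⊕ Fin Λ.t) ⊕ Fin Λ.L → Λ.V :=
  Sum.elim (Sum.elim (fun w => Sum.inr w) fun c => Sum.inl (Sum.inr (Fin.castAdd Λ.L c)))
    fun u => Sum.inl (Sum.inr (Fin.natAdd Λ.t u))

section Defs

variable (k)

/-- `VALID(w, c, u)`, the transcript consistency polynomial of the circuit. -/
def VP : MvPolynomial Λ.V k := rename Λ.ρ (validPoly (k := k) Λ.Q)

/-- The polynomial of output wire `j` (a transcript variable, an input variable, or `0`). -/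
def W (j : Fin Λ.n) : MvPolynomial Λ.V k := rename Λ.ρ (wirePoly (k := k) Λ.L (Λ.out j))

/-- The selector factor `1 + W_j (x_j - 1)`. -/
def factor (j : Fin Λ.n) : MvPolynomial Λ.V k := 1 + Λ.W k j * (X (Sum.inl (Sum.inl j)) + C (-1))

/-- The monomial selector `∏_j (1 + W_j (x_j - 1))`. -/
def PP : MvPolynomial Λ.V k := ∏ j : Fin Λ.n, Λ.factor k j

/-- **The witness** `G = VALID · ∏_j (1 + W_j (x_j - 1))`. -/
def G : MvPolynomial Λ.V k := Λ.VP k * Λ.PP k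

/-- The full Boolean substitution seen by `G` inside `boolSum (bitSubst i ·)`: `x ↦ x`,
`e ↦ [e]`, `w ↦ [bit w of i]`. -/
def Ψ (e : Fin Λ.ℓ → Bool) (i : ℕ) : Λ.V → MvPolynomial (Fin Λ.n) k :=
  Sum.elim (Sum.elim (fun j => X j) fun v => C (toK k (e v))) fun w => C (toK k (i.testBit w))

end Defs

/-- The selector block of a Boolean assignment. -/
def cOf (e : Fin Λ.ℓ → Bool) : Fin Λ.t → Bool := fun c => e (Fin.castAdd Λ.L c)

/-- The transcript block of a Boolean assignment. -/
def uOf (e : Fin Λ.ℓ → Bool) : Fin Λ.L → Bool := fun u => e (Fin.natAdd Λ.t u)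

/-- The circuit input determined by the index `i` and the selector bits. -/
def inp (i : ℕ) (c : Fin Λ.t → Bool) : Fin Λ.K ⊕ Fin Λ.t → Bool :=
  Sum.elim (fun w => i.testBit w) c

/-- The Boolean substitution of `boolSum` after `bitSubst i` is the full substitution `Ψ`. -/
theorem comp_bitSubst_eq (e : Fin Λ.ℓ → Bool) (i : ℕ) :
    (aeval (R := k) (Sum.elim X fun j => if e j then (1 : MvPolynomial (Fin Λ.n) k) else 0)).comp
      (bitSubst (σ := fun n => Fin n) Λ.n Λ.ℓ Λ.K i) = aeval (R := k) (Λ.Ψ k e i) := by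
  refine MvPolynomial.algHom_ext fun v => ?_
  rw [AlgHom.comp_apply, aeval_X]
  rcases v with (j | v) | w
  · simp [Ψ]
  · simp only [bitSubst_X_inl, aeval_X, Sum.elim_inr, Ψ, Sum.elim_inl]
    exact ite_eq_C_toK (e v)
  · simp only [bitSubst_X_inr, Ψ, Sum.elim_inr]
    cases i.testBit w <;> simp [toK]

/-- `boolSum ∘ bitSubst i` is the sum of the full Boolean substitutions. -/
theorem boolSum_bitSubst (Gp : MvPolynomial Λ.V k) (i : ℕ) :
    boolSum (bitSubst (σ := fun n => Fin n) Λ.n Λ.ℓ Λ.K i Gp) =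
      ∑ e : Fin Λ.ℓ → Bool, aeval (Λ.Ψ k e i) Gp := by
  unfold boolSum
  refine Finset.sum_congr rfl fun e _ => ?_
  rw [← AlgHom.comp_apply, comp_bitSubst_eq]

/-- Under `Ψ`, the placed transcript variables become the Boolean point `(inp i c, u)`. -/
theorem Ψ_comp_ρ (e : Fin Λ.ℓ → Bool) (i : ℕ) :
    Λ.Ψ k e i ∘ Λ.ρ = fun v => C (bpt k (Λ.inp i (Λ.cOf e)) (Λ.uOf e) v) := by
  funext v
  rcases v with (w | c) | u <;> rfl

/-- Scalar gadgets in `(w, c, u)` become constants. -/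
theorem aeval_Ψ_rename_ρ (e : Fin Λ.ℓ → Bool) (i : ℕ)
    (p : MvPolynomial ((Fin Λ.K ⊕ Fin Λ.t) ⊕ Fin Λ.L) k) :
    aeval (Λ.Ψ k e i) (rename Λ.ρ p) = C (eval (bpt k (Λ.inp i (Λ.cOf e)) (Λ.uOf e)) p) := by
  rw [aeval_rename, Ψ_comp_ρ]
  exact BoolGadgets.aeval_C_comp _ p

/-- `VALID` becomes the transcript indicator. -/
theorem aeval_Ψ_VP (e : Fin Λ.ℓ → Bool) (i : ℕ) :
    aeval (Λ.Ψ k e i) (Λ.VP k) =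
      C (eval (bpt k (Λ.inp i (Λ.cOf e)) (Λ.uOf e)) (validPoly (k := k) Λ.Q)) :=
  Λ.aeval_Ψ_rename_ρ e i _

/-- A selector factor becomes `x_j` or `1` according to the guessed value of wire `out j`. -/
theorem aeval_Ψ_factor (e : Fin Λ.ℓ → Bool) (i : ℕ) (j : Fin Λ.n) :
    aeval (Λ.Ψ k e i) (Λ.factor k j) =
      if bwval (Λ.inp i (Λ.cOf e)) (Λ.uOf e) (Λ.out j) then X j else 1 := by
  unfold factor W
  rw [map_add, map_one, map_mul, aeval_Ψ_rename_ρ, eval_wirePoly, map_add, aeval_X, aeval_C]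
  simp only [Ψ, Sum.elim_inl, algebraMap_eq]
  exact one_add_C_toK_mul _ _

/-- The selector becomes the monomial selected by the guessed output values. -/
theorem aeval_Ψ_PP (e : Fin Λ.ℓ → Bool) (i : ℕ) :
    aeval (Λ.Ψ k e i) (Λ.PP k) =
      selMonomial Λ.n fun j => bwval (Λ.inp i (Λ.cOf e)) (Λ.uOf e) (Λ.out j) := by
  unfold PP selMonomial
  rw [map_prod]
  exact Finset.prod_congr rfl fun j _ => Λ.aeval_Ψ_factor e i j

/-- The witness under a full Boolean substitution. -/
theorem aeval_Ψ_G (e : Fin Λ.ℓ → Bool) (i : ℕ) :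
    aeval (Λ.Ψ k e i) (Λ.G k) =
      C (eval (bpt k (Λ.inp i (Λ.cOf e)) (Λ.uOf e)) (validPoly (k := k) Λ.Q)) *
        selMonomial Λ.n fun j => bwval (Λ.inp i (Λ.cOf e)) (Λ.uOf e) (Λ.out j) := by
  unfold G
  rw [map_mul, aeval_Ψ_VP, aeval_Ψ_PP]

/-- **Valiant's criterion, as an identity**: summing the witness over the Boolean block with
the index bits substituted gives `Σ_c x^{D(bits i, c)}` (the transcript sum collapses `u` to
the true computation of the circuit). -/
theorem boolSum_G (i : ℕ) :
    boolSum (bitSubst (σ := fun n => Fin n) Λ.n Λ.ℓ Λ.K i (Λ.G k)) =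
      ∑ c : Fin Λ.t → Bool, selMonomial Λ.n (Λ.D (Λ.inp i c)) := by
  rw [boolSum_bitSubst]
  simp only [aeval_Ψ_G]
  refine (sum_boolVec_add Λ.t Λ.L fun c u =>
    C (eval (bpt k (Λ.inp i c) u) (validPoly (k := k) Λ.Q)) *
      selMonomial Λ.n fun j => bwval (Λ.inp i c) u (Λ.out j)).trans ?_
  refine Finset.sum_congr rfl fun c _ => ?_
  rw [RazDefinable.sum_C_validPoly_mul Λ.Q Λ.Q_isOver (Λ.inp i c) fun u =>
    selMonomial (k := k) Λ.n fun j => bwval (Λ.inp i c) u (Λ.out j)]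
  congr 1
  funext j
  rw [RazDefinable.bwval_trueTranscript]
  exact Λ.real.eval _ j

/-! ### Size and degree of the witness -/

/-- `L(factor j) ≤ 3`. -/
theorem complexity_factor_le (j : Fin Λ.n) : complexity (Λ.factor k j) ≤ 3 := by
  unfold factor
  have hW : complexity (Λ.W k j) ≤ 0 :=
    (complexity_rename_le_holds' _ _).trans_eq (complexity_wirePoly _)
  have hX : complexity (X (Sum.inl (Sum.inl j)) + C (-1) : MvPolynomial Λ.V k) ≤ 1 := by
    refine (complexity_add_le_holds _ _).trans ?_
    rw [complexity_X_holds, complexity_C_holds]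
  have h1 : complexity (1 : MvPolynomial Λ.V k) = 0 := by
    rw [← C_1]; exact complexity_C_holds _
  calc complexity (1 + Λ.W k j * (X (Sum.inl (Sum.inl j)) + C (-1)))
      ≤ complexity (1 : MvPolynomial Λ.V k) +
          complexity (Λ.W k j * (X (Sum.inl (Sum.inl j)) + C (-1))) + 1 :=
        complexity_add_le_holds _ _
    _ ≤ 0 + (0 + 1 + 1) + 1 := by
        gcongr
        · exact h1.le
        · exact (complexity_mul_le_holds _ _).trans (by omega)
    _ = 3 := rfl

/-- `L(G) ≤ 60 L + 4 n + 1`. -/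
theorem complexity_G_le : complexity (Λ.G k) ≤ 60 * Λ.L + 4 * Λ.n + 1 := by
  have h1 : complexity (Λ.VP k) ≤ 60 * Λ.L :=
    (complexity_rename_le_holds' _ _).trans (RazDefinable.complexity_validPoly_le Λ.Q)
  have h2 : complexity (Λ.PP k) ≤ 4 * Λ.n := by
    unfold PP
    refine (complexity_finset_prod_le _ _).trans ?_
    calc ∑ j : Fin Λ.n, complexity (Λ.factor k j) + (Finset.univ : Finset (Fin Λ.n)).card
        ≤ ∑ _j : Fin Λ.n, 3 + (Finset.univ : Finset (Fin Λ.n)).card := by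
          gcongr with j; exact Λ.complexity_factor_le j
      _ = 4 * Λ.n := by
          simp only [Finset.sum_const, Finset.card_univ, Fintype.card_fin, smul_eq_mul]; ring
  unfold G
  exact (complexity_mul_le_holds _ _).trans (by omega)

/-- `deg (factor j) ≤ 2`. -/
theorem totalDegree_factor_le (j : Fin Λ.n) : (Λ.factor k j).totalDegree ≤ 2 := by
  unfold factor
  have hW : (Λ.W k j).totalDegree ≤ 1 :=
    (totalDegree_rename_le _ _).trans (totalDegree_wirePoly_le _)
  have hX : (X (Sum.inl (Sum.inl j)) + C (-1) : MvPolynomial Λ.V k).totalDegree ≤ 1 :=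
    (totalDegree_add _ _).trans (max_le (totalDegree_X_le_one' (k := k) _) (by simp))
  refine (totalDegree_add _ _).trans (max_le (by simp) ?_)
  exact (totalDegree_mul _ _).trans (by omega)

/-- `deg G ≤ 3 L + 2 n`. -/
theorem totalDegree_G_le : (Λ.G k).totalDegree ≤ 3 * Λ.L + 2 * Λ.n := by
  have h1 : (Λ.VP k).totalDegree ≤ 3 * Λ.L :=
    (totalDegree_rename_le _ _).trans (RazDefinable.totalDegree_validPoly_le Λ.Q)
  have h2 : (Λ.PP k).totalDegree ≤ 2 * Λ.n := by
    unfold PP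
    refine (totalDegree_finsetProd _ _).trans ?_
    calc ∑ j : Fin Λ.n, (Λ.factor k j).totalDegree ≤ ∑ _j : Fin Λ.n, 2 :=
          Finset.sum_le_sum fun j _ => Λ.totalDegree_factor_le j
      _ = 2 * Λ.n := by
          simp only [Finset.sum_const, Finset.card_univ, Fintype.card_fin, smul_eq_mul]; ring
  unfold G
  exact (totalDegree_mul _ _).trans (by omega)

end WDatum

/-! ### Valiant's criterion for polynomial mappings -/

/-- **The witness at one index.** From a `B₂`-circuit of size `≤ s` computing the exponent
bit-vectors `D(w, c) ∈ {0,1}ⁿ` from `K` index bits `w` and `t ≥ 1` selector bits `c`: a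
polynomial `G(x, e, w)` with `ℓ ≤ t + s` Boolean variables, `L(G) ≤ 60 s + 4 n + 1`,
`deg G ≤ 3 s + 2 n`, and `Σ_e G(x, e, bits i) = Σ_c x^{D(bits i, c)}` for every `i`
(Bürgisser 2000, Prop. 2.20, for mappings; Raz 2010, remark after Def. 1.3). -/
theorem exists_mapWitness {K t n s : ℕ} (ht : 0 < t) (D : (Fin K ⊕ Fin t → Bool) → Fin n → Bool)
    (hD : CktSize B2 D s) :
    ∃ (ℓ : ℕ) (G : MvPolynomial ((Fin n ⊕ Fin ℓ) ⊕ Fin K) k), ℓ ≤ t + s ∧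
      complexity G ≤ 60 * s + 4 * n + 1 ∧ G.totalDegree ≤ 3 * s + 2 * n ∧
        ∀ i : ℕ, boolSum (bitSubst (σ := fun n => Fin n) n ℓ K i G) =
          ∑ c : Fin t → Bool, selMonomial n (D (Sum.elim (fun w => i.testBit w) c)) := by
  obtain ⟨gs, out, hlen, hreal⟩ := hD
  let Λ : WDatum := ⟨n, K, t, ht, gs, out, D, hreal⟩
  have hL : Λ.L ≤ s := hlen
  have hn : Λ.n = n := rfl
  exact ⟨Λ.ℓ, Λ.G k, Nat.add_le_add_left hL _, Λ.complexity_G_le.trans (by omega),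
    Λ.totalDegree_G_le.trans (by omega), fun i => Λ.boolSum_G i⟩

/-- **Valiant's criterion for polynomial mappings** (Raz 2010, remark after Def. 1.3;
Bürgisser 2000, Prop. 2.20): a family `f n : Fin (m n) → k[x_0..x_{n-1}]` whose coordinates are
`f n i = Σ_{c ∈ {0,1}^{t(n)}} x^{D_n(bits i, c)}` with the exponent bit-vectors `D_n` computed by
`B₂`-circuits of p-bounded size `s(n)` (`t` p-bounded, `t ≥ 1`) is poly(`n`)-definable
(`IsPolyDefinableMap`, Def. 1.3). -/
theorem isPolyDefinableMap_of_cktSize {m t s : ℕ → ℕ}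
    (D : ∀ n, (Fin (Nat.clog 2 (m n)) ⊕ Fin (t n) → Bool) → Fin n → Bool)
    (ht : ∀ n, 0 < t n) (hD : ∀ n, CktSize B2 (D n) (s n)) (hs : IsPBounded s)
    (htp : IsPBounded t) (f : ∀ n, Fin (m n) → MvPolynomial (Fin n) k)
    (hf : ∀ n (i : Fin (m n)), f n i =
      ∑ c : Fin (t n) → Bool, selMonomial n (D n (Sum.elim (fun w => (i : ℕ).testBit w) c))) :
    IsPolyDefinableMap (m := m) (σ := fun n => Fin n) f := by
  have key := fun n => exists_mapWitness (k := k) (ht n) (D n) (hD n)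
  choose ℓ G hℓ hGc hGd hG using key
  refine ⟨ℓ, G, (IsPBounded.add_holds htp hs).mono hℓ, ?_, ?_, fun n i => by rw [hf, hG]⟩
  · exact (IsPBounded.add_holds (IsPBounded.mul_holds (IsPBounded.const 3) hs)
      (IsPBounded.mul_holds (IsPBounded.const 2) IsPBounded.id)).mono hGd
  · exact (IsPBounded.add_holds (IsPBounded.add_holds (IsPBounded.mul_holds (IsPBounded.const 60)
      hs) (IsPBounded.mul_holds (IsPBounded.const 4) IsPBounded.id)) (IsPBounded.const 1)).mono hGc

end Summit.ValiantsHypothesis.ValiantsHypothesis.Theorems.BinomialElusiveRazTransfer
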